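import Mathlib
import Literature.NumberTheory.LFunctions.Zhang2022.RepairBedAssumptionAPrimitive
import Literature.NumberTheory.LFunctions.Zhang2022.RepairBedScale
import HarnessLib

/-!
# Zhang (2022), rescue bed (D-0124 (3)) honesty rule H2 at its natural range: Assumption (A) is false for
# EVERY real primitive character of conductor `≤ e^{40440}` — the whole range of the trivial bound `h ≥ 1`

Topic `Literature/NumberTheory/LFunctions/Zhang2022` (Landau–Siegel audit tree; verdict-neutral).
Y. Zhang, *Discrete mean estimates and the Landau–Siegel zero*, arXiv:2211.02515v1 (2022)
[Zhang2022LandauSiegel] — **an unrefereed manuscript under adjudication; nothing in this file asserts or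
denies its Theorems 1–2, and nothing here is a claim about Landau–Siegel zeros. The programme SEARCHES and
TYPES; no claim about Landau–Siegel zeros, Theorems 1–2 of arXiv:2211.02515 or a repaired Margin232 until a
kernel theorem says so.**

`RepairBedAssumptionAVacuous` (rev 4/5) and `RepairBedAssumptionAPrimitive` refute
`Skeleton.AssumptionA q χ := ‖L(1,χ)‖ < 1/(log q)^2022` for every primitive quadratic `χ` of modulus
`1 < q ≤ 10¹²`, comparing `L(1,χ_D) ≥ (3/4)/√|D|` (class number `≥ 1`; regulator `≥ log((1+√5)/2) ≥ 3/8`) with the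
crude `(log|D|)^2022 ≥ (log 5)^32`. The desk's prose (N2) quoted in BED §0.2 (H2) states the natural range of that
trivial argument: «`L(1,χ_D) ≫ (log D)^{−2022}` for `3 ≤ |D| ≤ e^{4·10⁴}`». This file makes the range a kernel fact.
The only new ingredient is ONE CONVEXITY STEP on `exp`:

* (private) `exp_le_chord` — `exp t ≤ 1 + (e^K − 1)·t/K` on `[0, K]` (`convexOn_exp`); with `K = 1` (`e < 2.7182818286`)
  and `K = 10` (`e^{10} < 22 026.47`): `1.0002·e^{u/4044} ≤ u` for `1.0264 ≤ u ≤ 40 440`, hence, raising to the 2022nd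
  power and using Bernoulli `1.0002^2022 ≥ 1.4044 ≥ 4/3`: **`(4/3)·e^{u/2} ≤ u^2022`**;
* (private) `one_div_log_pow_le_of_log_le` — for `3 ≤ D` with `log D ≤ 40 440`: `1/(log D)^2022 ≤ (3/4)/√D`;
* `three_quarters_div_sqrt_le_LOne` — for EVERY fundamental discriminant `D`: `(3/4)/√|D| ≤ LOne D = L(1,χ_D)`
  (`D > 0`: `2 h_K R_K/√D`, `R_K ≥ 3/8`; `D < −4`: `π h(D)/√|D|`; `D = −3, −4` by value);
* `not_assumptionA_of_re_ge_sqrt` (any `χ (mod D)`, `3 ≤ D`, `log D ≤ 40 440`, `Re L(1,χ) ≥ (3/4)/√D`),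
  `not_assumptionA_kroneckerChar_of_log_natAbs_le` (every fundamental `D` with `log|D| ≤ 40 440`),
  **`not_assumptionA_of_isPrimitive_isQuadratic_of_log_le`** (every primitive quadratic `χ (mod q)`, `1 < q`,
  `log q ≤ 40 440`) and the decimal corollary `not_assumptionA_of_isPrimitive_isQuadratic_le_pow17500`
  (`1 < q ≤ 10^17500`; `log 10 < 2.3105` from `log 1000 ≤ log 1024 = 10 log 2`);
* `aExponent_kroneckerChar_le` — the bed's «(A)-exponent» axis (`Repair.Bed.aExponent`, G1-01 / GAP G-31) gets the
  explicit ceiling `aExponent |D| χ_D ≤ (log|D|/2 + log(4/3)) / log log|D|` for every fundamental `|D| ≥ 3`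
  ((A) needs `> 2022`, `Repair.Bed.assumptionA_iff_lt_aExponent`).

So (A), AS TYPED with the exponent 2022, can hold — if at all — only at conductors `q > e^{40440} > 10^{17500}`; below
that it is refuted pointwise by `h ≥ 1` alone. (The true crossover of the trivial bound is near `log q ≈ 4.3·10⁴`; the
chord with `K = 10` stops at `40 440`.) This is the bed's honesty rule H2 at full strength and NOTHING MORE: it says
nothing about (A) for large `D`, which is the manuscript's subject (`Skeleton.theorem1_of_eventually_not_assumptionA`
needs `¬(A)` beyond every bound). Theorems only; no definition, no named fact.

## References

* Y. Zhang, arXiv:2211.02515v1 (2022), §2 Assumption (A) p. 4. [cite: Zhang2022LandauSiegel, §2 Assumption (A)]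
* H. Davenport, *Multiplicative Number Theory*, 2nd ed. (1980), Ch. 6 (class number formula). [cite: DavenportMNT1980, Ch. 6]
* H. L. Montgomery, R. C. Vaughan, *Multiplicative Number Theory I*, CUP 2007, Theorem 9.13.
  [cite: MontgomeryVaughan2007, Theorem 9.13]
-/

noncomputable section

open Complex Real DirichletCharacter

namespace Literature.NumberTheory.LFunctions.Zhang2022.Repair.Bed.Vacuity

open Skeleton Literature.NumberTheory.LFunctions.Zhang2022.Repair.Bed
open Literature.NumberTheory.LFunctions.KroneckerCharacter
open Literature.NumberTheory.QuadraticFields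

/-! ## One convexity step on `exp` -/

/-- The chord bound for the convex function `exp` on `[0, K]`: `exp t ≤ 1 + (e^K − 1)·(t/K)`. [folklore] -/
private theorem exp_le_chord {K t : ℝ} (hK : 0 < K) (h0 : 0 ≤ t) (ht : t ≤ K) :
    Real.exp t ≤ 1 + (Real.exp K - 1) * (t / K) := by
  have hb : 0 ≤ t / K := div_nonneg h0 hK.le
  have ha : 0 ≤ 1 - t / K := by rw [sub_nonneg, div_le_one hK]; exact ht
  have h := convexOn_exp.2 (Set.mem_univ (0 : ℝ)) (Set.mem_univ K) ha hb (by ring)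
  simp only [smul_eq_mul, mul_zero, zero_add, Real.exp_zero, mul_one] at h
  have htK : t / K * K = t := div_mul_cancel₀ t hK.ne'
  rw [htK] at h
  have : (1 - t / K) + t / K * Real.exp K = 1 + (Real.exp K - 1) * (t / K) := by ring
  linarith

/-- `e^{10} < 22 026.47` (`e < 2.7182818286`). [folklore] -/
private theorem exp_ten_lt : Real.exp 10 < 22026.47 := by
  have h := Real.exp_one_lt_d9
  have h0 := (Real.exp_pos 1).le
  have h10 : Real.exp 10 = Real.exp 1 ^ 10 := by
    rw [← Real.exp_nat_mul]; norm_num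
  rw [h10]
  calc Real.exp 1 ^ 10 ≤ (2.7182818286 : ℝ) ^ 10 := pow_le_pow_left₀ h0 h.le 10
    _ < 22026.47 := by norm_num

/-- **For `1.0264 ≤ u ≤ 40 440`: `1.0002·e^{u/4044} ≤ u`** — the chord with `K = 1` on `u ≤ 4044`
(`1.0002·(1 + 1.71829·u/4044) ≤ u` iff `u ≥ 1.0007`) and with `K = 10` on `4044 ≤ u ≤ 40 440`
(`1.0002·(1 + 2202.55·u/4044) ≤ u` iff `u ≥ 2.2`). [folklore] -/
private theorem mul_exp_div_le {u : ℝ} (h1 : (1.0264 : ℝ) ≤ u) (h2 : u ≤ 40440) :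
    (1 + 0.0002) * Real.exp (u / 4044) ≤ u := by
  have hnn : 0 ≤ u / 4044 := div_nonneg (by linarith) (by norm_num)
  rcases le_or_gt u 4044 with hu | hu
  · have hc := exp_le_chord (K := 1) one_pos hnn (by linarith)
    have he := Real.exp_one_lt_d9
    have hE : Real.exp (u / 4044) ≤ 1 + 1.7182818286 * (u / 4044) := by
      calc Real.exp (u / 4044) ≤ 1 + (Real.exp 1 - 1) * (u / 4044 / 1) := hc
        _ ≤ 1 + 1.7182818286 * (u / 4044) := by
          rw [div_one]
          have : (Real.exp 1 - 1) * (u / 4044) ≤ 1.7182818286 * (u / 4044) :=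
            mul_le_mul_of_nonneg_right (by linarith) hnn
          linarith
    linarith
  · have hc := exp_le_chord (K := 10) (by norm_num) hnn (by linarith)
    have he := exp_ten_lt
    have hE : Real.exp (u / 4044) ≤ 1 + 2202.547 * (u / 4044) := by
      calc Real.exp (u / 4044) ≤ 1 + (Real.exp 10 - 1) * (u / 4044 / 10) := hc
        _ = 1 + (Real.exp 10 - 1) / 10 * (u / 4044) := by ring
        _ ≤ 1 + 2202.547 * (u / 4044) := by
          have h' : (Real.exp 10 - 1) / 10 ≤ 2202.547 := by
            rw [div_le_iff₀ (by norm_num)]; linarith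
          have := mul_le_mul_of_nonneg_right h' hnn
          linarith
    linarith

/-- **For `1.0264 ≤ u ≤ 40 440`: `(4/3)·e^{u/2} ≤ u^2022`** — raise `1.0002·e^{u/4044} ≤ u` to the 2022nd power
(`(e^{u/4044})^2022 = e^{u/2}`) and use Bernoulli `(1 + 0.0002)^2022 ≥ 1 + 2022·0.0002 ≥ 4/3` (no numeral is raised to
the 2022nd power). [folklore] -/
private theorem exp_half_le_pow {u : ℝ} (h1 : (1.0264 : ℝ) ≤ u) (h2 : u ≤ 40440) :
    4 / 3 * Real.exp (u / 2) ≤ u ^ 2022 := by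
  have hkey := mul_exp_div_le h1 h2
  have hpos : 0 ≤ (1 + 0.0002) * Real.exp (u / 4044) := by positivity
  have hpow : ((1 + 0.0002) * Real.exp (u / 4044)) ^ 2022 ≤ u ^ 2022 := pow_le_pow_left₀ hpos hkey 2022
  have hexp : Real.exp (u / 4044) ^ 2022 = Real.exp (u / 2) := by
    rw [← Real.exp_nat_mul]; congr 1; ring
  have hB : (1 : ℝ) + (2022 : ℕ) * (0.0002 : ℝ) ≤ (1 + 0.0002) ^ 2022 := one_add_mul_le_pow (by norm_num) 2022
  have h43 : (4 : ℝ) / 3 ≤ (1 + 0.0002 : ℝ) ^ 2022 := le_trans (by norm_num) hB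
  calc 4 / 3 * Real.exp (u / 2) ≤ (1 + 0.0002 : ℝ) ^ 2022 * Real.exp (u / 2) :=
        mul_le_mul_of_nonneg_right h43 (Real.exp_pos _).le
    _ = ((1 + 0.0002) * Real.exp (u / 4044)) ^ 2022 := by rw [mul_pow, hexp]
    _ ≤ u ^ 2022 := hpow

/-- `log 3 ≥ 1.0264` (`log 3 = log 2 + log (3/2)`, `log 2 > 0.6931471803`, `log (3/2) ≥ 1 − 2/3`). [folklore] -/
private theorem log_three_ge' : (1.0264 : ℝ) ≤ Real.log 3 := by
  have h2 := Real.log_two_gt_d9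
  have h32 : (1 : ℝ) - (3 / 2 : ℝ)⁻¹ ≤ Real.log (3 / 2) := Real.one_sub_inv_le_log_of_pos (by norm_num)
  have : Real.log 3 = Real.log 2 + Real.log (3 / 2) := by
    rw [← Real.log_mul (by norm_num) (by norm_num)]; norm_num
  rw [this]; norm_num at h32 ⊢; linarith

/-- `log 10 < 2.3105` (`3 log 10 = log 1000 ≤ log 1024 = 10 log 2 < 6.931471808`). [folklore] -/
private theorem log_ten_lt : Real.log 10 < 2.3105 := by
  have h2 := Real.log_two_lt_d9
  have h3 : Real.log 1000 = 3 * Real.log 10 := by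
    rw [show (1000 : ℝ) = 10 ^ 3 by norm_num, Real.log_pow]; norm_num
  have h10 : Real.log 1024 = 10 * Real.log 2 := by
    rw [show (1024 : ℝ) = 2 ^ 10 by norm_num, Real.log_pow]; norm_num
  have hle : Real.log 1000 ≤ Real.log 1024 := Real.log_le_log (by norm_num) (by norm_num)
  linarith

/-! ## The analytic comparison `(log D)^{−2022} ≤ (3/4)/√D` below `e^{40440}` -/

/-- **For `3 ≤ D` with `log D ≤ 40 440`: `1/(log D)^2022 ≤ (3/4)/√D`** (`√D = e^{(log D)/2}` and
`(4/3)e^{u/2} ≤ u^2022` on `[log 3, 40 440]`). [folklore] -/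
private theorem one_div_log_pow_le_of_log_le {D : ℕ} (h3 : 3 ≤ D) (hlog : Real.log D ≤ 40440) :
    1 / Real.log D ^ 2022 ≤ (3 / 4 : ℝ) / Real.sqrt D := by
  have hD : (0 : ℝ) < D := by exact_mod_cast (show 0 < D by omega)
  have hu : (1.0264 : ℝ) ≤ Real.log D :=
    le_trans log_three_ge' (Real.log_le_log (by norm_num) (by exact_mod_cast h3))
  have hmain := exp_half_le_pow hu hlog
  have hsq : Real.exp (Real.log D / 2) ^ 2 = D := by
    rw [← Real.exp_nat_mul]; push_cast
    rw [show (2 : ℝ) * (Real.log D / 2) = Real.log D by ring, Real.exp_log hD]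
  have hsqrt : Real.sqrt D = Real.exp (Real.log D / 2) := by
    have := Real.sqrt_sq (Real.exp_pos (Real.log D / 2)).le
    rwa [hsq] at this
  have hlogpos : 0 < Real.log D := by linarith
  have hpow : 0 < Real.log D ^ 2022 := pow_pos hlogpos _
  have hs : 0 < Real.sqrt D := Real.sqrt_pos.mpr hD
  rw [div_le_div_iff₀ hpow hs, one_mul, hsqrt]
  linarith

/-! ## The generic refutation below `e^{40440}` -/

/-- **`Re L(1,χ) ≥ (3/4)/√D` refutes Assumption (A) at any modulus `3 ≤ D ≤ e^{40440}`**, for ANY Dirichlet character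
`χ (mod D)`: `‖L(1,χ)‖ ≥ Re L(1,χ) ≥ (3/4)/√D ≥ 1/(log D)^2022`. [cite: Zhang2022LandauSiegel, §2 Assumption (A)] -/
theorem not_assumptionA_of_re_ge_sqrt {D : ℕ} [NeZero D] (χ : DirichletCharacter ℂ D) (h3 : 3 ≤ D)
    (hlog : Real.log D ≤ 40440) (h : (3 / 4 : ℝ) / Real.sqrt D ≤ (χ.LFunction 1).re) : ¬ AssumptionA D χ := by
  intro hA
  unfold AssumptionA at hA
  have hre : (χ.LFunction 1).re ≤ ‖χ.LFunction 1‖ := Complex.re_le_norm _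
  have hcmp := one_div_log_pow_le_of_log_le h3 hlog
  linarith

/-! ## The trivial lower bound `L(1,χ_D) ≥ (3/4)/√|D|` at every fundamental discriminant -/

/-- The cast of `Int.natAbs` to `ℝ` is the absolute value. [folklore] -/
private theorem cast_natAbs_eq_abs (D : ℤ) : ((D.natAbs : ℕ) : ℝ) = |(D : ℝ)| := by
  rw [← Int.cast_natCast, Int.natCast_natAbs, Int.cast_abs]

/-- **`L(1,χ_D) ≥ (3/4)/√|D|` for EVERY fundamental discriminant `D`** (`Repair.Bed.LOne D = Re L(1, kroneckerChar D)`):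
`D > 0`: `LOne D = 2 h_K R_K/√D` (`LOne_eq_of_discr_pos`) with `h_K ≥ 1`, `R_K ≥ log((1+√5)/2) ≥ 3/8`
(`Quadratic.log_goldenRatio_le_regulator`); `D < −4`: `LOne D = π h(D)/√|D|` (`LOne_eq_pi_mul_classNumber_div_sqrt`) with
`h(D) ≥ 1`; `D = −4`: `π/4`; `D = −3`: `π/(3√3)`. The class-number-formula floor behind every vacuity statement of the bed.
[cite: DavenportMNT1980, Ch. 6] -/
theorem three_quarters_div_sqrt_le_LOne {D : ℤ}
    (hfd : Literature.Barriers.RiemannHypothesis.IsFundamentalDiscriminant D) :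
    (3 / 4 : ℝ) / Real.sqrt |(D : ℝ)| ≤ LOne D := by
  rcases lt_or_ge 0 D with hpos | hnonpos
  · -- real quadratic: 2 h R/√D
    obtain ⟨K, _, _, h2, hdK⟩ := Quadratic.exists_numberField_discr_eq hfd
    have hd' : 0 < NumberField.discr K := by rw [hdK]; exact hpos
    have hL : LOne D = 2 * NumberField.classNumber K * NumberField.Units.regulator K / Real.sqrt (D : ℝ) :=
      LOne_eq_of_discr_pos h2 hdK hpos
    have hR : (3 : ℝ) / 8 ≤ NumberField.Units.regulator K :=
      le_trans Quadratic.three_eighths_le_log_goldenRatio (Quadratic.log_goldenRatio_le_regulator h2 hd')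
    have hh : (1 : ℝ) ≤ NumberField.classNumber K := by
      have : 1 ≤ NumberField.classNumber K := by unfold NumberField.classNumber; exact Fintype.card_pos
      exact_mod_cast this
    have hDpos : (0 : ℝ) < D := by exact_mod_cast hpos
    have hsqrt : 0 < Real.sqrt (D : ℝ) := Real.sqrt_pos.mpr hDpos
    rw [abs_of_pos hDpos, hL, div_le_div_iff₀ hsqrt hsqrt]
    have hprod : (3 : ℝ) / 8 ≤ NumberField.classNumber K * NumberField.Units.regulator K := by
      have h0' : (0 : ℝ) ≤ NumberField.Units.regulator K := by linarith
      nlinarith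
    nlinarith
  · rcases lt_or_ge D (-4) with hlt | hge
    · -- imaginary quadratic, `D < −4`: π h/√|D|
      rw [LOne_eq_pi_mul_classNumber_div_sqrt hfd hlt]
      have hmod : D % 4 = 0 ∨ D % 4 = 1 := by
        rcases hfd with ⟨h1, -, -⟩ | ⟨h4d, -, -⟩
        · exact Or.inr h1
        · exact Or.inl (Int.emod_eq_zero_of_dvd h4d)
      have hh : (1 : ℝ) ≤ Quadratic.BinQF.classNumber D := by
        exact_mod_cast Quadratic.BinQF.classNumber_pos (by omega) hmod
      have habs : (0 : ℝ) < |(D : ℝ)| := by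
        have : (D : ℝ) < 0 := by exact_mod_cast (show D < 0 by omega)
        exact abs_pos.mpr this.ne
      have hsqrt : 0 < Real.sqrt |(D : ℝ)| := Real.sqrt_pos.mpr habs
      rw [div_le_div_iff₀ hsqrt hsqrt]
      have hπh : (3 / 4 : ℝ) ≤ Real.pi * Quadratic.BinQF.classNumber D := by
        nlinarith [Real.pi_gt_three, hh]
      exact mul_le_mul_of_nonneg_right hπh hsqrt.le
    · -- `−4 ≤ D ≤ 0`: only `D = −4, −3` are fundamental
      have hD : D = -4 ∨ D = -3 ∨ D = -2 ∨ D = -1 ∨ D = 0 := by omega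
      rcases hD with rfl | rfl | rfl | rfl | rfl
      · rw [LOne_neg4]
        have hs : (2 : ℝ) = Real.sqrt |((-4 : ℤ) : ℝ)| := by
          rw [show |((-4 : ℤ) : ℝ)| = 2 ^ 2 by norm_num, Real.sqrt_sq (by norm_num)]
        rw [← hs]
        linarith [Real.pi_gt_three]
      · rw [LOne_neg3]
        have h3 : |((-3 : ℤ) : ℝ)| = 3 := by norm_num
        rw [h3]
        have hs0 : 0 < Real.sqrt 3 := Real.sqrt_pos.mpr (by norm_num)
        rw [div_le_div_iff₀ hs0 (by positivity)]
        nlinarith [Real.pi_gt_three]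
      all_goals
        exfalso
        rcases hfd with ⟨h1, -, -⟩ | ⟨h4, h23, -⟩ <;> omega

/-! ## (A) is false at `χ_D` for every fundamental `|D| ≤ e^{40440}` -/

/-- **Assumption (A) is false at `χ_D = kroneckerChar D` for EVERY fundamental discriminant with `log|D| ≤ 40 440`**
(i.e. `|D| ≤ e^{40440}`, beyond `10^{17500}`): `L(1,χ_D) ≥ (3/4)/√|D| ≥ 1/(log|D|)^2022`. Supersedes the `|D| ≤ 10¹²`
range of `not_assumptionA_kroneckerChar_of_natAbs_le_1e12` — the rescue bed's honesty rule H2 at the full range of the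
trivial bound `h ≥ 1`; nothing about (A) for larger `D`. [cite: Zhang2022LandauSiegel, §2 Assumption (A)]
[cite: DavenportMNT1980, Ch. 6] -/
theorem not_assumptionA_kroneckerChar_of_log_natAbs_le {D : ℤ}
    (hfd : Literature.Barriers.RiemannHypothesis.IsFundamentalDiscriminant D) (hlog : Real.log D.natAbs ≤ 40440) :
    ∃ h0 : D ≠ 0, haveI : NeZero D.natAbs := ⟨Int.natAbs_ne_zero.mpr h0⟩
      ¬ AssumptionA D.natAbs (kroneckerChar D) := by
  have h0 : D ≠ 0 := by
    rintro rfl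
    rcases hfd with ⟨h1, -, -⟩ | ⟨-, h23, -⟩ <;> omega
  have h3 : 3 ≤ D.natAbs := by
    by_contra hlt
    have hD : D = -2 ∨ D = -1 ∨ D = 0 ∨ D = 1 ∨ D = 2 := by omega
    rcases hD with rfl | rfl | rfl | rfl | rfl <;>
      rcases hfd with ⟨h1, -, h1ne⟩ | ⟨h4, h23, -⟩ <;> omega
  haveI : NeZero D.natAbs := ⟨Int.natAbs_ne_zero.mpr h0⟩
  refine ⟨h0, not_assumptionA_of_re_ge_sqrt _ h3 hlog ?_⟩
  rw [← LOne_eq_re h0, cast_natAbs_eq_abs]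
  exact three_quarters_div_sqrt_le_LOne hfd

/-! ## (A) for an arbitrary real primitive character of conductor `≤ e^{40440}` -/

/-- **Assumption (A) of arXiv:2211.02515 is false for EVERY primitive quadratic Dirichlet character `χ` of modulus
`1 < q` with `log q ≤ 40 440`** (`q ≤ e^{40440}`): `χ` is the Kronecker character `χ_D`, `D = χ(−1)q` fundamental, moved to
level `q` (`changeLevel_kroneckerChar_eq`), `L(1,χ) = L(1,χ_D)` (empty Euler correction), and
`not_assumptionA_kroneckerChar_of_log_natAbs_le`. The manuscript's (A) concerns `D → ∞`; this is the bed's honesty rule H2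
(«(A) is vacuous at every modulus any computation reaches») at the natural range of `h ≥ 1`, nothing more.
[cite: Zhang2022LandauSiegel, §2 Assumption (A)] [cite: MontgomeryVaughan2007, Theorem 9.13] -/
theorem not_assumptionA_of_isPrimitive_isQuadratic_of_log_le {q : ℕ} [NeZero q] {χ : DirichletCharacter ℂ q}
    (hprim : χ.IsPrimitive) (hquad : χ.IsQuadratic) (h1 : 1 < q) (hlog : Real.log q ≤ 40440) :
    ¬ AssumptionA q χ := by
  obtain ⟨s, hpar, hs, hfd, hDq⟩ := exists_sign_fundamental hprim hquad h1
  have h0 : s * (q : ℤ) ≠ 0 := by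
    intro h; rw [h] at hDq; simp at hDq; exact (NeZero.ne q) hDq.symm
  haveI hne : NeZero (s * (q : ℤ)).natAbs := ⟨Int.natAbs_ne_zero.mpr h0⟩
  have hdvd : (s * (q : ℤ)).natAbs ∣ q := by rw [hDq]
  -- (1) χ is the Kronecker character moved to level q
  have hχ := changeLevel_kroneckerChar_eq hprim hquad hpar hfd hdvd hDq
  -- (2) the L-values agree (empty Euler correction)
  have hL : (changeLevel hdvd (kroneckerChar (s * q))).LFunction 1 = (kroneckerChar (s * q)).LFunction 1 := by
    rw [LFunction_changeLevel hdvd _ (Or.inl (kroneckerChar_ne_one hfd))]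
    have hprod : ∏ p ∈ q.primeFactors, (1 - kroneckerChar (s * q) (p : ZMod (s * (q : ℤ)).natAbs) *
        (p : ℂ) ^ (-(1 : ℂ))) = 1 := by
      refine Finset.prod_eq_one fun p hp => ?_
      have hpp : p.Prime := Nat.prime_of_mem_primeFactors hp
      have hpq : p ∣ (s * (q : ℤ)).natAbs := by rw [hDq]; exact Nat.dvd_of_mem_primeFactors hp
      have hnu : ¬ IsUnit ((p : ℕ) : ZMod (s * (q : ℤ)).natAbs) := by
        rw [ZMod.isUnit_prime_iff_not_dvd hpp]; exact fun h => h hpq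
      rw [MulChar.map_nonunit _ hnu, zero_mul, sub_zero]
    rw [hprod, mul_one]
  -- (3) the Kronecker character violates (A); transport
  obtain ⟨h0', hκ⟩ := not_assumptionA_kroneckerChar_of_log_natAbs_le hfd (by rw [hDq]; exact hlog)
  intro hA
  apply hκ
  unfold AssumptionA at hA ⊢
  rw [← hL, hχ]
  have hcast : ((s * (q : ℤ)).natAbs : ℝ) = (q : ℝ) := by exact_mod_cast hDq
  rw [hcast]
  exact hA

/-- **Decimal corollary: (A) is false for every primitive quadratic `χ` of modulus `1 < q ≤ 10^17500`**
(`log q ≤ 17 500·log 10 < 17 500·2.3105 < 40 440`; the bound is stated on the real cast `(q : ℝ) ≤ 10^17500` so that no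
tactic evaluates the 17 500-digit numeral). [cite: Zhang2022LandauSiegel, §2 Assumption (A)]
[cite: MontgomeryVaughan2007, Theorem 9.13] -/
theorem not_assumptionA_of_isPrimitive_isQuadratic_le_pow17500 {q : ℕ} [NeZero q] {χ : DirichletCharacter ℂ q}
    (hprim : χ.IsPrimitive) (hquad : χ.IsQuadratic) (h1 : 1 < q) (hq : (q : ℝ) ≤ (10 : ℝ) ^ 17500) :
    ¬ AssumptionA q χ := by
  refine not_assumptionA_of_isPrimitive_isQuadratic_of_log_le hprim hquad h1 ?_
  have hq0 : (0 : ℝ) < q := by exact_mod_cast (show 0 < q by omega)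
  have hle : Real.log q ≤ Real.log ((10 : ℝ) ^ 17500) := Real.log_le_log hq0 hq
  rw [Real.log_pow] at hle
  have h10 := log_ten_lt
  push_cast at hle
  nlinarith

/-! ## The «(A)-exponent» ceiling of every genuine real primitive character -/

/-- **`aExponent |D| χ_D ≤ (log|D|/2 + log(4/3)) / log log|D|` for every fundamental discriminant with `|D| ≥ 3`**
(`Repair.Bed.aExponent D χ = −log‖L(1,χ)‖/log log D`, the bed's G1-01 axis on which (A) reads `> 2022`,
`Repair.Bed.assumptionA_iff_lt_aExponent`): from `‖L(1,χ_D)‖ ≥ LOne D ≥ (3/4)/√|D|`. E.g. `≤ 4.4` at `|D| = 10¹²` and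
`≤ 2022` until `log|D| ≈ 4.3·10⁴`. [cite: Zhang2022LandauSiegel, §2 Assumption (A)] [cite: DavenportMNT1980, Ch. 6] -/
theorem aExponent_kroneckerChar_le {D : ℤ}
    (hfd : Literature.Barriers.RiemannHypothesis.IsFundamentalDiscriminant D) (h3 : 3 ≤ D.natAbs) :
    ∃ h0 : D ≠ 0, haveI : NeZero D.natAbs := ⟨Int.natAbs_ne_zero.mpr h0⟩
      aExponent D.natAbs (kroneckerChar D) ≤
        (Real.log D.natAbs / 2 + Real.log (4 / 3)) / Real.log (Real.log D.natAbs) := by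
  have h0 : D ≠ 0 := by intro h; rw [h] at h3; simp at h3
  haveI : NeZero D.natAbs := ⟨Int.natAbs_ne_zero.mpr h0⟩
  refine ⟨h0, ?_⟩
  have hD : (0 : ℝ) < (D.natAbs : ℝ) := by exact_mod_cast (show 0 < D.natAbs by omega)
  have hlog1 : (1.0264 : ℝ) ≤ Real.log D.natAbs :=
    le_trans log_three_ge' (Real.log_le_log (by norm_num) (by exact_mod_cast h3))
  have hll : 0 < Real.log (Real.log D.natAbs) := Real.log_pos (by linarith)
  -- the floor `‖L(1,χ_D)‖ ≥ (3/4)/√|D| > 0`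
  have hfloor : (3 / 4 : ℝ) / Real.sqrt (D.natAbs : ℝ) ≤ ‖(kroneckerChar D).LFunction (1 : ℂ)‖ := by
    have h1 := three_quarters_div_sqrt_le_LOne hfd
    rw [← cast_natAbs_eq_abs, LOne_eq_re h0] at h1
    exact le_trans h1 (Complex.re_le_norm _)
  have hs : 0 < Real.sqrt (D.natAbs : ℝ) := Real.sqrt_pos.mpr hD
  have hfl0 : (0 : ℝ) < (3 / 4 : ℝ) / Real.sqrt (D.natAbs : ℝ) := by positivity
  have hnorm : 0 < ‖(kroneckerChar D).LFunction (1 : ℂ)‖ := lt_of_lt_of_le hfl0 hfloor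
  -- `−log‖L‖ ≤ −log((3/4)/√|D|) = log(4/3) + (log|D|)/2`
  have hlogle : Real.log ((3 / 4 : ℝ) / Real.sqrt (D.natAbs : ℝ)) ≤ Real.log ‖(kroneckerChar D).LFunction (1 : ℂ)‖ :=
    Real.log_le_log hfl0 hfloor
  have hlogfloor : Real.log ((3 / 4 : ℝ) / Real.sqrt (D.natAbs : ℝ)) =
      -Real.log (4 / 3) - Real.log D.natAbs / 2 := by
    rw [Real.log_div (by norm_num) hs.ne', Real.log_sqrt hD.le,
      show (3 / 4 : ℝ) = (4 / 3)⁻¹ by norm_num, Real.log_inv]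
  unfold aExponent
  rw [div_le_div_iff_of_pos_right hll]
  linarith

end Literature.NumberTheory.LFunctions.Zhang2022.Repair.Bed.Vacuity
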